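import Literature.MathematicalPhysics.QuantumFieldTheory.Balaban1983to89.B9Cor36GCubeLocDefectCore
import Literature.MathematicalPhysics.QuantumFieldTheory.Balaban1983to89.B9Thm37CommutatorBound389Majorant

/-!
# `Balaban1983to89.B9Cor36GCubeLocDefectCover` — THE SUM OVER THE COVER CUBES OF A MEMBER OF THE DEFECT LETTERS `conj b(E_□)`, `conj b(E♯_□)` OF THE
# BOND-SECTOR CUBE LETTERS: FINITE OVERLAP `3·5^{d+1}` OF THE ROWS MEETING `supp h_□`, HENCE `Σ_□ conj b(E_□) ≺ 3·5^{d+1}·(M₂Σ‖b‖)²·κ·e^{−a_sep·δ₀·M_h}·e^{−ρδ₀d}`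
# — THE 4th FAMILIES OF M5.7's `hrest` ∕ `hV'` (sub-row G-B9-LETTERS, module M5.1b-G item 2, programme DEFECT-R, FILE D3; design (R) term, NOT in print)

statement-level skeleton of published theorems with citation tags; proofs where landed; nothing here is a claim about the Yang–Mills mass gap

THE PRINTED LOCUS (verbatim, held `paper:balaban1985-cmp99-background-propagators`, journal page = PDF page + 388).  (3.105) p. 414: «T = Σ_□ h_□ … h_□ … |T| ≦ ½»;
p. 411 l. 12–14 («separated at least by a distance MLʲη»); p. 412 l. 31–36; (3.91) p. 410 («□′ ∩ □ ≠ ∅» — finitely many cubes meet a cube); Cor. 3.6 p. 408;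
[4] (2.36) p. 229 («Σ_□ h_□² = 1», the cubes □ and their finite overlap), p. 235, (2.79)–(2.85) pp. 237–238, (2.51)–(2.55) p. 232.

WHY THIS FILE.  D2 `B9Cor36GCubeLocDefectCore` (this seat) gives, PER COVER CUBE □ of a member, `conj b(E_□) ≺ (M₂Σ‖b_j‖)²·𝟙_□(a)·κ·e^{−ρδ₀d(a,a′)}` over the member's
geometry with the ROW INDICATOR `𝟙_□(a)` = «the member block `a` holds a bond whose cube block meets `supp h_□`» (and the same for `E♯_□`).  M5.7's consumer
`B9Thm310DeltaAIsUnitOfExpansion.eBlock_kernelFamilyBInv_GAY_of_localInverseCubes''` reads the defects only through the SUMS `Σ_□ conj b(E_□)` (4th family of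
`hrest`, flat kernel `Θ′·e^{−δ₀d}`) and `Σ_□ conj b(E♯_□)` (4th family of `hV'`, kernel `θ_V′·ℓ(a)·ℓ(a′)⁻¹·e^{−δ₀d}`).  THIS FILE sums: such a bond's member block lies in
p21's reach set `QT □` (§1: `supp h_□ ⊂` blocks of `N_□`, which are twins, so the member block of the bond is the member block of the witnessing site of
`supp h_□`, which is in `QT □` by p38∕p21's `blkOf_mem_QT_of_hT_ne_zero`), every member block lies in `≤ 3·5^{d+1}` reach sets (p21 `card_filter_mem_QT_le` ∕
p33 `sum_indicator_QT_le`), so r03's `B9Thm37Sum.hasMajorant_localSum` gives the two sums (§2); §3 converts the flat `E♯` sum into the `ℓ(a)·ℓ(a′)⁻¹` currency of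
`hV'` by ONE member-side scale transfer of `ℓ` (displayed, [9] p. 398 remark).

WHAT THIS FILE CERTIFIES (kernel-checked; 0 `def`, 0 `def … : Prop`, 0 sorry; standard axioms only)

* §1 `mem_nearN_of_hTY_ne_zero` (`h_□(z) ≠ 0 ⇒ blk_□ z ∈ N_□`), `blkOf_eq_of_row` (a bond whose cube block is the cube block of a site of `supp h_□` has that site's
  MEMBER block), ★ `rowInd_le_indicator_QT` (`𝟙_□(a) ≤ 𝟙[βa ∈ QT □]`), ★ `sum_rowInd_le` (`Σ_□ 𝟙_□(a) ≤ 3·5^{d+1}`).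
* §2 ★★★ `hasMajorant_sum_conj_locDefectBY` ∕ ★★★ `hasMajorant_sum_conj_locDefectTBY` — GIVEN, for every cover cube □, D2's displayed data at □ (`hP □`: a block
  majorant `K_P·ℓ_□⁻²·e^{−a_Pδ₀d_□}` of `conj b(DP_□D*(Ṽ_□))`; `hG □`: `B_G·ℓ_□²·e^{−b_Gδ₀d_□}` for `GVK(Ṽ_□)`; (2.61) at `b − ρ` and the scale transfer of `ℓ_□^{±2}`
  on the cube geometry; one set of constants for all cubes) and bi-contractive gauges `u_□`:
  `Σ_□ conj b(E_□(u_□, χ_□, h_□; Ṽ_□)) ≺ 3·5^{d+1}·(M₂Σ‖b_j‖)²·(K_PB_GΛc₁·e^{−a_sep·δ₀·M_h})·e^{−ρδ₀·d(a,a′)}` over `(toB6 (geo9K i) Rr′ Hp, ιB∘blkV1)` (resp. `E♯_□`).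
* §3 ★★ `hasMajorant_sum_conj_locDefectTBY_src` — the `E♯` sum in `hV'`'s currency: with a member-side scale transfer `e^{−α_m ρδ₀ d(a,a′)}ℓ(a′) ≤ Λ_m·ℓ(a)`,
  `≺ (3·5^{d+1}·(M₂Σ‖b_j‖)²·κ♯·Λ_m)·ℓ(a)·ℓ(a′)⁻¹·e^{−(1−α_m)ρδ₀·d(a,a′)}`.

HONEST SCOPE ∕ NOT CLAIMED.  (i) (R)-design terms (as D1∕D2).  (ii) DISPLAYED: D2's per-cube data `hP` (layer D2a — the block majorant of `conj b(DP_□D*(Ṽ_□))` from the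
landed `G′_□`, `Q′`, `C_□` letters is NOT produced here), `hG` (G-F7 v1.1 at `Ṽ_□`), (2.61) ∕ scale transfers above the member thresholds (p33 `exists_h261_geoCK`,
`hST_geoCK`), the member-side scale transfer of §3, the numerical side conditions; the smallness bookkeeping `3·5^{d+1}(M₂Σ‖b‖)²κ·e^{−a_sep·δ₀·M_h}·c₁ ≤ …` against
M5.7's `hsmall ∕ hsmallV` is the assembler's (it is where «M sufficiently large», p. 412 l. 31–36, is spent).  (iii) NOT here: families 1–3 of `hrest` ∕ `hV'` (the
ζ-words of (3.105); r06's R-Ker series), the (3.35) datum per cube.  Count-neutral; NOT a node discharge; no summit ∕ sub-problem statement is proved; nothing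
continuum ∕ OS ∕ mass-gap ∕ Clay; YM mass gap NOT proved (Track A conditional rung).  No `sorry`, no `axiom`, no `… : Prop` fact, no `instance`, no `notation`,
no `def`.  NEW file; nothing landed is modified.  Cell `lit-balaban`, seat `lit-balaban-p33` gen 102, 2026-08-28; `--supports stmt-QuantumFields-19200` as helper.
Net new unproved facts: 0.

RELATED IN THE TREE, NOT DUPLICATED (searched 2026-08-28: `rg 'localSum'` users = r03∕p21 M5.5–M5.7 sums of `h_□`-sandwiched letters, none for `locDefectBY`):
D2 `B9Cor36GCubeLocDefectCore`, D1 `B9Cor36GCubeLocDefectTransfer`, p21 `B9Cor36CubeTwinsGeometry` (`nearN`, `val_mem_of_mem_nearN`, `nearC_corner_of_nearC`,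
`eight_mul_bS_le_SC`), p21 `B9Cor36CinvCubeLocLetter.blkOf_eq_iff_of_val_eq`, `B6Partition118KLevelTorusCentral.blkOf_mem_QT_of_hT_ne_zero`,
p33 `B9Thm37CommutatorBound389Majorant.sum_indicator_QT_le`, r03 `B9Thm37Sum.hasMajorant_localSum` — all USED BY NAME.
-/

noncomputable section

namespace Literature.MathematicalPhysics.QuantumFieldTheory.Balaban1983to89.B9Cor36GCubeLocDefectCover

open B6RandomWalk (HasMajorant hasMajorant_mono Ineq261 c1_nonneg)
open B9Thm34Ext (toB6)
open B9Thm37Sum (hasMajorant_localSum)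
open B9Ineq347 (ScaleTransfer)
open B9Eq352DivFormLetters (conj)
open B6KLevelCensusIndexV1 (KIdx)
open B6Cover236MultiLevelBlocks (cubes)
open B6GlobalChartV1 (blkV1)
open B6Geom246MultiLevelBox (blkOf)
open B6Ineq2142KLevelV1 (β)
open B6Partition118KLevelTorusCentral (QT blkOf_mem_QT_of_hT_ne_zero)
open B9GeoNormsKLevelV1 (geo9K)
open B9GeoLemma21KLevelV1 (one_le_Mh)
open B9Thm37CubeCoverCommutators (hTY hTY_apply)
open B9Thm37CubeCoverCommutatorSizes (side_conditions four_le_P')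
open B9Thm37CommutatorBound389Majorant (sum_indicator_QT_le)
open B9Eq3105AtLetters (DPDsCubeY)
open B9CubeLettersBondOpsL0 (BlkCubeY)
open B9Eq360DeltaPrimeACubeY (blkCubeY)
open B9CubeGeometryInputs (geoCK)
open B9Cor35GCubeInputsAtOne (blkBK GVK)
open B9Cor36CubeCutoffs (SC NearC chiY nearC_of_hT_ne_zero)
open B9Cor36CubeTwinsGeometry (bS nearN mem_nearN val_mem_of_mem_nearN nearC_corner_of_nearC eight_mul_bS_le_SC one_le_bS)
open B9Cor36CinvCubeLocLetter (blkOf_eq_iff_of_val_eq)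
open B9Cor36GCubeLocLetter (locDefectBY locDefectTBY)
open B9Cor36GCubeLocDefectCore (hasMajorant_conj_locDefectBY hasMajorant_conj_locDefectTBY)
open Node00 (SiteY BlkY IBondY FBondY CfgY GaugeY SiteParY BondParY toKT)
open Node00.OpsYNablaBridge (chartY)

variable {d ℓ : ℕ} {hd : 1 ≤ d + 1} {hL : Odd (ℓ + 1) ∧ 1 < ℓ + 1} {b₀ b₁ : ℝ}
variable {𝔸 : Type} [NormedRing 𝔸] [NormedAlgebra ℂ 𝔸] [CompleteSpace 𝔸]
variable {ι : Type} [Fintype ι]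

/-! ## §1  The rows meeting `supp h_□` lie in the reach set `QT □`; finite overlap `3·5^{d+1}` -/

section Geometry

variable (i : KIdx d ℓ hd hL b₀ b₁) (c : ↥(cubes (toKT i).D.toDomains))

/-- `h_□(z) ≠ 0 ⇒` the cube block of `z` belongs to `N_□` (`supp h_□ ⊂ {≤ S_j}`, corners move by `< L^{j+1} ≤ S_j∕8`).
[cite: Balaban1985BackgroundPropagators, p.408, p.411 l.12–14; Balaban1984PropagatorsII, (2.36) p.229, (2.45) p.231, bookkeeping] -/
theorem mem_nearN_of_hTY_ne_zero {z : SiteY i} (hz : hTY i c z ≠ 0) : blkCubeY i c z ∈ nearN i c := by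
  have h₁ : NearC i c (SC i c) z.1 := nearC_of_hT_ne_zero i c (by rwa [hTY_apply] at hz)
  have h₂ := nearC_corner_of_nearC i c h₁
  have h8 := eight_mul_bS_le_SC i c
  have hb : (1 : ℤ) ≤ (bS i c : ℤ) := by exact_mod_cast one_le_bS i c
  exact (mem_nearN i c).2 (h₂.mono i c (by linarith))

/-- a bond whose cube block is the cube block of a site `z` of `supp h_□` has the MEMBER block of `z` (the blocks of `N_□` are twins: p21's `val_mem_of_mem_nearN`,
`blkOf_eq_iff_of_val_eq`). [cite: Balaban1985BackgroundPropagators, p.408 (□̃³ ⊂ Ω_j(□)); Balaban1984PropagatorsII, (2.45) p.231, bookkeeping] -/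
theorem blkOf_eq_of_row {w z : SiteY i} (hzw : blkCubeY i c z = blkCubeY i c w) (hz : hTY i c z ≠ 0) :
    blkOf i.D.toDomains w = blkOf i.D.toDomains z := by
  have hs1 := val_mem_of_mem_nearN i c (mem_nearN_of_hTY_ne_zero i c hz)
  have e1 : blkOf i.D.toDomains z = ⟨(blkCubeY i c z).1, hs1⟩ :=
    (blkOf_eq_iff_of_val_eq i c (t := ⟨(blkCubeY i c z).1, hs1⟩) (s := blkCubeY i c z) rfl z).2 rfl
  have e2 : blkOf i.D.toDomains w = ⟨(blkCubeY i c z).1, hs1⟩ :=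
    (blkOf_eq_iff_of_val_eq i c (t := ⟨(blkCubeY i c z).1, hs1⟩) (s := blkCubeY i c z) rfl w).2 hzw.symm
  rw [e1, e2]

open Classical in
/-- ★ **THE ROW INDICATOR OF D2 IS DOMINATED BY THE REACH-SET INDICATOR**: if the member block `a` holds a bond whose cube block meets `supp h_□`, then `βa ∈ QT □`.
[cite: Balaban1985BackgroundPropagators, (3.91) p.410, p.408; Balaban1984PropagatorsII, p.235, (2.36) p.229] -/
theorem rowInd_le_indicator_QT (ιB : BlkY i → IBondY i) (hι : ∀ s, β i.hN i.D i.hk (ιB s) = s) (a : IBondY i) :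
    (if ∃ x : FBondY i, ιB (blkOf i.D.toDomains (chartY i x.src)) = a ∧
          ∃ z : SiteY i, blkCubeY i c z = blkCubeY i c (chartY i x.src) ∧ hTY i c z ≠ 0 then (1 : ℝ) else 0) ≤
      (if β i.hN i.D i.hk a ∈ QT i.D (one_le_Mh i) (four_le_P' i) c then (1 : ℝ) else 0) := by
  obtain ⟨_, hMh2, hR, _⟩ := side_conditions i
  split_ifs with h1 h2
  · exact le_rfl
  · exfalso
    obtain ⟨x, hxa, z, hzx, hz⟩ := h1
    apply h2
    rw [← hxa, hι, blkOf_eq_of_row i c hzx hz]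
    exact blkOf_mem_QT_of_hT_ne_zero (D := i.D) hMh2 hR (four_le_P' i) c (by rwa [hTY_apply] at hz)
  · norm_num
  · exact le_rfl

open Classical in
/-- ★ **FINITE OVERLAP OF THE DEFECT ROWS**: every member block holds bonds meeting `supp h_□` for at most `3·5^{d+1}` cover cubes □ (p21's `card_filter_mem_QT_le`
through `sum_indicator_QT_le`). [cite: Balaban1985BackgroundPropagators, (3.91) p.410 («□′ ∩ □ ≠ ∅»), (3.105) p.414; Balaban1984PropagatorsII, (2.36) p.229, p.235] -/
theorem sum_rowInd_le (ιB : BlkY i → IBondY i) (hι : ∀ s, β i.hN i.D i.hk (ιB s) = s) (a : IBondY i) :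
    (∑ c : ↥(cubes (toKT i).D.toDomains),
        if ∃ x : FBondY i, ιB (blkOf i.D.toDomains (chartY i x.src)) = a ∧
            ∃ z : SiteY i, blkCubeY i c z = blkCubeY i c (chartY i x.src) ∧ hTY i c z ≠ 0 then (1 : ℝ) else 0) ≤ 3 * 5 ^ (d + 1) :=
  (Finset.sum_le_sum fun c _ => rowInd_le_indicator_QT i c ιB hι a).trans (sum_indicator_QT_le i a)

end Geometry

/-! ## §2  The cover sums of the two defect letters -/

section Cover

variable (i : KIdx d ℓ hd hL b₀ b₁) (parS : SiteParY 𝔸 i) (parB : BondParY 𝔸 i) (b : Module.Basis ι ℝ 𝔸)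

open Classical in
set_option maxHeartbeats 1600000 in
/-- ★★★ **THE 4th FAMILY OF `hrest`: `Σ_□ conj b(E_□) ≺ 3·5^{d+1}·(M₂Σ‖b_j‖)²·(K_PB_GΛc₁(δ₀,b_G−ρ)·e^{−a_sep·δ₀·M_h})·e^{−ρδ₀d(a,a′)}`** over the member's
`(toB6 (geo9K i) Rr′ Hp, ιB∘blkV1)`, GIVEN at every cover cube □ the displayed data of D2 (`hP □`, `hG □`, (2.61) at `b_G − ρ`, the scale transfer of `ℓ_□²` at
`α_st`; constants uniform in □), `α_st + a_sep + ρ ≦ a_P`, and bi-contractive gauges `u_□`.  D2 per cube, the finite overlap `Σ_□ 𝟙_□(a) ≤ 3·5^{d+1}` (§1) and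
r03's `hasMajorant_localSum`.
[cite: Balaban1985BackgroundPropagators, (3.105) p.414, (3.87) p.409, p.411 l.12–14, p.412 l.31–36, (3.91) p.410, Cor. 3.6 p.408; Balaban1984PropagatorsII, (2.79)–(2.85) pp.237–238, (2.51)–(2.55) p.232, (2.36) p.229, Lemma 2.1 (2.61) p.234] -/
theorem hasMajorant_sum_conj_locDefectBY {M₂ : ℝ} (hM₂ : 0 ≤ M₂) (hrepr : ∀ (v : 𝔸) (j : ι), |b.repr v j| ≤ M₂ * ‖v‖)
    (u : ↥(cubes (toKT i).D.toDomains) → GaugeY 𝔸 i) (hu : ∀ c x, ‖((u c x : 𝔸ˣ) : 𝔸)‖ ≤ 1 ∧ ‖(((u c x)⁻¹ : 𝔸ˣ) : 𝔸)‖ ≤ 1)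
    (V : ↥(cubes (toKT i).D.toDomains) → CfgY 𝔸 i)
    (ιB : BlkY i → IBondY i) (hι : ∀ s, β i.hN i.D i.hk (ιB s) = s) (Rr : ℝ) (H : Prop) [Fintype (geo9K i).Site] (Rr' : ℝ) (Hp : Prop)
    (dB : ℕ) {δ₀ aP bG αst asep ρ KP BG Λ : ℝ}
    (hδ₀ : 0 ≤ δ₀) (hKP : 0 ≤ KP) (hBG : 0 ≤ BG) (hΛ : 0 ≤ Λ) (hasep : 0 ≤ asep) (hρ : 0 ≤ ρ) (hsplit : αst + asep + ρ ≤ aP)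
    (h261 : ∀ c : ↥(cubes (toKT i).D.toDomains), Ineq261 dB (toB6 (geoCK i c) Rr H) δ₀ (bG - ρ))
    (hST : ∀ c : ↥(cubes (toKT i).D.toDomains), ScaleTransfer (geoCK i c) δ₀ αst Λ (fun a => (geoCK i c).len a ^ 2))
    (hP : ∀ c : ↥(cubes (toKT i).D.toDomains), HasMajorant (g := toB6 (geoCK i c) Rr H) (blkBK i c) (conj b ((DPDsCubeY i c parS (V c)).restrictScalars ℝ))
      (fun a y => KP * ((geoCK i c).len a ^ 2)⁻¹ * Real.exp (-(aP * δ₀ * (geoCK i c).dist a y))))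
    (hG : ∀ c : ↥(cubes (toKT i).D.toDomains), HasMajorant (g := toB6 (geoCK i c) Rr H) (blkBK i c) (GVK b i c parS parB (V c))
      (fun y b' => BG * (geoCK i c).len y ^ 2 * Real.exp (-(bG * δ₀ * (geoCK i c).dist y b')))) :
    HasMajorant (g := toB6 (geo9K i) Rr' Hp) (fun p : FBondY i × ι => ιB (blkV1 i.hN i.D p.1))
      (∑ c : ↥(cubes (toKT i).D.toDomains), conj b ((locDefectBY i c parS parB (u c) (chiY i c) (hTY i c) (V c)).restrictScalars ℝ))
      (fun a a' => (3 * 5 ^ (d + 1)) * ((M₂ * ∑ j, ‖b j‖) ^ 2 *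
        ((KP * BG * Λ * B6.c1 dB δ₀ (bG - ρ) * Real.exp (-(asep * δ₀ * (toKT i).Mh))) * Real.exp (-(ρ * δ₀ * (geo9K i).dist a a'))))) := by
  have hκ : 0 ≤ KP * BG * Λ * B6.c1 dB δ₀ (bG - ρ) * Real.exp (-(asep * δ₀ * (toKT i).Mh)) :=
    mul_nonneg (mul_nonneg (mul_nonneg (mul_nonneg hKP hBG) hΛ) (c1_nonneg _ _ _)) (Real.exp_nonneg _)
  have hSb : 0 ≤ (M₂ * ∑ j, ‖b j‖) ^ 2 := sq_nonneg _
  refine hasMajorant_localSum (G := toB6 (geo9K i) Rr' Hp) (fun p : FBondY i × ι => ιB (blkV1 i.hN i.D p.1))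
    (fun c => conj b ((locDefectBY i c parS parB (u c) (chiY i c) (hTY i c) (V c)).restrictScalars ℝ))
    (fun c a => if ∃ x : FBondY i, ιB (blkOf i.D.toDomains (chartY i x.src)) = a ∧
          ∃ z : SiteY i, blkCubeY i c z = blkCubeY i c (chartY i x.src) ∧ hTY i c z ≠ 0 then (1 : ℝ) else 0)
    (fun a a' => (M₂ * ∑ j, ‖b j‖) ^ 2 *
        ((KP * BG * Λ * B6.c1 dB δ₀ (bG - ρ) * Real.exp (-(asep * δ₀ * (toKT i).Mh))) * Real.exp (-(ρ * δ₀ * (geo9K i).dist a a'))))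
    (3 * 5 ^ (d + 1)) (fun a a' => mul_nonneg hSb (mul_nonneg hκ (Real.exp_nonneg _))) (fun c => ?_) (sum_rowInd_le i ιB hι)
  refine hasMajorant_mono (g := toB6 (geo9K i) Rr' Hp) _
    (hasMajorant_conj_locDefectBY i c parS parB b hM₂ hrepr (u c) (hu c) (V c) ιB hι Rr H Rr' Hp dB hδ₀ hKP hBG hΛ hasep hρ hsplit
      (h261 c) (hST c) (hP c) (hG c)) fun a a' => le_of_eq ?_
  split_ifs <;> ring

open Classical in
set_option maxHeartbeats 1600000 in
/-- ★★★ **THE 4th FAMILY OF `hV'` (flat form): `Σ_□ conj b(E♯_□) ≺ 3·5^{d+1}·(M₂Σ‖b_j‖)²·(B_GK_PΛc₁(δ₀,a_P−ρ)·e^{−a_sep·δ₀·M_h})·e^{−ρδ₀d(a,a′)}`** over the member's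
geometry, GIVEN at every cover cube the displayed data of D2's `hasMajorant_core_ET` (`hG □` on the left at rate `b_G`, `hP □` on the right at rate `a_P`, (2.61) at
`a_P − ρ`, the scale transfer of `ℓ_□⁻²`), `α_st + a_sep + ρ ≦ b_G`, bi-contractive `u_□`.
[cite: Balaban1985BackgroundPropagators, (3.105) p.414, (3.87) p.409, p.411 l.12–14, p.412 l.31–36, (3.91) p.410, Cor. 3.6 p.408; Balaban1984PropagatorsII, (2.79)–(2.85) pp.237–238, (2.51)–(2.55) p.232, (2.36) p.229, Lemma 2.1 (2.61) p.234] -/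
theorem hasMajorant_sum_conj_locDefectTBY {M₂ : ℝ} (hM₂ : 0 ≤ M₂) (hrepr : ∀ (v : 𝔸) (j : ι), |b.repr v j| ≤ M₂ * ‖v‖)
    (u : ↥(cubes (toKT i).D.toDomains) → GaugeY 𝔸 i) (hu : ∀ c x, ‖((u c x : 𝔸ˣ) : 𝔸)‖ ≤ 1 ∧ ‖(((u c x)⁻¹ : 𝔸ˣ) : 𝔸)‖ ≤ 1)
    (V : ↥(cubes (toKT i).D.toDomains) → CfgY 𝔸 i)
    (ιB : BlkY i → IBondY i) (hι : ∀ s, β i.hN i.D i.hk (ιB s) = s) (Rr : ℝ) (H : Prop) [Fintype (geo9K i).Site] (Rr' : ℝ) (Hp : Prop)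
    (dB : ℕ) {δ₀ aP bG αst asep ρ KP BG Λ : ℝ}
    (hδ₀ : 0 ≤ δ₀) (hKP : 0 ≤ KP) (hBG : 0 ≤ BG) (hΛ : 0 ≤ Λ) (hasep : 0 ≤ asep) (hρ : 0 ≤ ρ) (hsplit : αst + asep + ρ ≤ bG)
    (h261 : ∀ c : ↥(cubes (toKT i).D.toDomains), Ineq261 dB (toB6 (geoCK i c) Rr H) δ₀ (aP - ρ))
    (hST : ∀ c : ↥(cubes (toKT i).D.toDomains), ScaleTransfer (geoCK i c) δ₀ αst Λ (fun a => ((geoCK i c).len a ^ 2)⁻¹))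
    (hG : ∀ c : ↥(cubes (toKT i).D.toDomains), HasMajorant (g := toB6 (geoCK i c) Rr H) (blkBK i c) (GVK b i c parS parB (V c))
      (fun a y => BG * (geoCK i c).len a ^ 2 * Real.exp (-(bG * δ₀ * (geoCK i c).dist a y))))
    (hP : ∀ c : ↥(cubes (toKT i).D.toDomains), HasMajorant (g := toB6 (geoCK i c) Rr H) (blkBK i c) (conj b ((DPDsCubeY i c parS (V c)).restrictScalars ℝ))
      (fun y b' => KP * ((geoCK i c).len y ^ 2)⁻¹ * Real.exp (-(aP * δ₀ * (geoCK i c).dist y b')))) :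
    HasMajorant (g := toB6 (geo9K i) Rr' Hp) (fun p : FBondY i × ι => ιB (blkV1 i.hN i.D p.1))
      (∑ c : ↥(cubes (toKT i).D.toDomains), conj b ((locDefectTBY i c parS parB (u c) (chiY i c) (hTY i c) (V c)).restrictScalars ℝ))
      (fun a a' => (3 * 5 ^ (d + 1)) * ((M₂ * ∑ j, ‖b j‖) ^ 2 *
        ((BG * KP * Λ * B6.c1 dB δ₀ (aP - ρ) * Real.exp (-(asep * δ₀ * (toKT i).Mh))) * Real.exp (-(ρ * δ₀ * (geo9K i).dist a a'))))) := by
  have hκ : 0 ≤ BG * KP * Λ * B6.c1 dB δ₀ (aP - ρ) * Real.exp (-(asep * δ₀ * (toKT i).Mh)) :=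
    mul_nonneg (mul_nonneg (mul_nonneg (mul_nonneg hBG hKP) hΛ) (c1_nonneg _ _ _)) (Real.exp_nonneg _)
  have hSb : 0 ≤ (M₂ * ∑ j, ‖b j‖) ^ 2 := sq_nonneg _
  refine hasMajorant_localSum (G := toB6 (geo9K i) Rr' Hp) (fun p : FBondY i × ι => ιB (blkV1 i.hN i.D p.1))
    (fun c => conj b ((locDefectTBY i c parS parB (u c) (chiY i c) (hTY i c) (V c)).restrictScalars ℝ))
    (fun c a => if ∃ x : FBondY i, ιB (blkOf i.D.toDomains (chartY i x.src)) = a ∧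
          ∃ z : SiteY i, blkCubeY i c z = blkCubeY i c (chartY i x.src) ∧ hTY i c z ≠ 0 then (1 : ℝ) else 0)
    (fun a a' => (M₂ * ∑ j, ‖b j‖) ^ 2 *
        ((BG * KP * Λ * B6.c1 dB δ₀ (aP - ρ) * Real.exp (-(asep * δ₀ * (toKT i).Mh))) * Real.exp (-(ρ * δ₀ * (geo9K i).dist a a'))))
    (3 * 5 ^ (d + 1)) (fun a a' => mul_nonneg hSb (mul_nonneg hκ (Real.exp_nonneg _))) (fun c => ?_) (sum_rowInd_le i ιB hι)
  refine hasMajorant_mono (g := toB6 (geo9K i) Rr' Hp) _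
    (hasMajorant_conj_locDefectTBY i c parS parB b hM₂ hrepr (u c) (hu c) (V c) ιB hι Rr H Rr' Hp dB hδ₀ hKP hBG hΛ hasep hρ hsplit
      (h261 c) (hST c) (hG c) (hP c)) fun a a' => le_of_eq ?_
  split_ifs <;> ring

/-! ## §3  The `E♯` sum in the source-weighted currency `ℓ(a)·ℓ(a′)⁻¹` of `hV'` -/

/-- the weight conversion: a flat kernel is `≤ Λ_m·ℓ(a)·ℓ(a′)⁻¹·e^{+α_m δ d(a,a′)}` under the member-side scale transfer of `ℓ` ([9] p. 398 remark: lengths of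
blocks along a path change by bounded factors, paid by a fraction of the decay). [cite: Balaban1985BackgroundPropagators, p.398 (remark after (3.47)); Balaban1984PropagatorsII, (2.46) p.231, bookkeeping] -/
theorem flat_le_src_weight [Fintype (geo9K i).Site] {δ αm Λm κ : ℝ} (hκ : 0 ≤ κ)
    (hSTm : ScaleTransfer (geo9K i) δ αm Λm (fun a => (geo9K i).len a)) (a a' : (geo9K i).Site) :
    κ * Real.exp (-(δ * (geo9K i).dist a a')) ≤
      (κ * Λm) * (geo9K i).len a * ((geo9K i).len a')⁻¹ * Real.exp (-((1 - αm) * δ * (geo9K i).dist a a')) := by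
  have hla : 0 < (geo9K i).len a := B6KLevelCensusIndexV1.len_pos i a
  have hla' : 0 < (geo9K i).len a' := B6KLevelCensusIndexV1.len_pos i a'
  have hT := hSTm a a'
  -- `e^{−α_m δ d}·ℓ(a′) ≤ Λ_m ℓ(a)` ⇒ `e^{−δd} ≤ Λ_m ℓ(a) ℓ(a′)⁻¹ e^{−(1−α_m)δ d}`
  have hsplit : Real.exp (-(δ * (geo9K i).dist a a')) =
      Real.exp (-(αm * δ * (geo9K i).dist a a')) * Real.exp (-((1 - αm) * δ * (geo9K i).dist a a')) := by
    rw [← Real.exp_add]; congr 1; ring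
  have key : Real.exp (-(αm * δ * (geo9K i).dist a a')) ≤ Λm * (geo9K i).len a * ((geo9K i).len a')⁻¹ := by
    rw [← div_eq_mul_inv, le_div_iff₀ hla']
    simpa [mul_comm, mul_left_comm, mul_assoc] using hT
  rw [hsplit]
  calc κ * (Real.exp (-(αm * δ * (geo9K i).dist a a')) * Real.exp (-((1 - αm) * δ * (geo9K i).dist a a')))
      = κ * Real.exp (-(αm * δ * (geo9K i).dist a a')) * Real.exp (-((1 - αm) * δ * (geo9K i).dist a a')) := by ring
    _ ≤ κ * (Λm * (geo9K i).len a * ((geo9K i).len a')⁻¹) * Real.exp (-((1 - αm) * δ * (geo9K i).dist a a')) :=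
        mul_le_mul_of_nonneg_right (mul_le_mul_of_nonneg_left key hκ) (Real.exp_nonneg _)
    _ = (κ * Λm) * (geo9K i).len a * ((geo9K i).len a')⁻¹ * Real.exp (-((1 - αm) * δ * (geo9K i).dist a a')) := by ring

open Classical in
set_option maxHeartbeats 1600000 in
/-- ★★ **THE 4th FAMILY OF `hV'` IN ITS CURRENCY**: the flat `E♯` sum of `hasMajorant_sum_conj_locDefectTBY` and ONE member-side scale transfer
`e^{−α_m(ρδ₀)d(a,a′)}ℓ(a′) ≤ Λ_m ℓ(a)` give `Σ_□ conj b(E♯_□) ≺ (3·5^{d+1}(M₂Σ‖b_j‖)²κ♯Λ_m)·ℓ(a)·ℓ(a′)⁻¹·e^{−(1−α_m)ρδ₀d(a,a′)}`.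
[cite: Balaban1985BackgroundPropagators, (3.105) p.414, p.398 (remark after (3.47)), p.411 l.12–14, Cor. 3.6 p.408; Balaban1984PropagatorsII, (2.79)–(2.85) pp.237–238, (2.46) p.231, (2.36) p.229] -/
theorem hasMajorant_sum_conj_locDefectTBY_src {M₂ : ℝ} (hM₂ : 0 ≤ M₂) (hrepr : ∀ (v : 𝔸) (j : ι), |b.repr v j| ≤ M₂ * ‖v‖)
    (u : ↥(cubes (toKT i).D.toDomains) → GaugeY 𝔸 i) (hu : ∀ c x, ‖((u c x : 𝔸ˣ) : 𝔸)‖ ≤ 1 ∧ ‖(((u c x)⁻¹ : 𝔸ˣ) : 𝔸)‖ ≤ 1)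
    (V : ↥(cubes (toKT i).D.toDomains) → CfgY 𝔸 i)
    (ιB : BlkY i → IBondY i) (hι : ∀ s, β i.hN i.D i.hk (ιB s) = s) (Rr : ℝ) (H : Prop) [Fintype (geo9K i).Site] (Rr' : ℝ) (Hp : Prop)
    (dB : ℕ) {δ₀ aP bG αst asep ρ KP BG Λ αm Λm : ℝ}
    (hδ₀ : 0 ≤ δ₀) (hKP : 0 ≤ KP) (hBG : 0 ≤ BG) (hΛ : 0 ≤ Λ) (hasep : 0 ≤ asep) (hρ : 0 ≤ ρ) (hsplit : αst + asep + ρ ≤ bG)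
    (h261 : ∀ c : ↥(cubes (toKT i).D.toDomains), Ineq261 dB (toB6 (geoCK i c) Rr H) δ₀ (aP - ρ))
    (hST : ∀ c : ↥(cubes (toKT i).D.toDomains), ScaleTransfer (geoCK i c) δ₀ αst Λ (fun a => ((geoCK i c).len a ^ 2)⁻¹))
    (hSTm : ScaleTransfer (geo9K i) (ρ * δ₀) αm Λm (fun a => (geo9K i).len a))
    (hG : ∀ c : ↥(cubes (toKT i).D.toDomains), HasMajorant (g := toB6 (geoCK i c) Rr H) (blkBK i c) (GVK b i c parS parB (V c))
      (fun a y => BG * (geoCK i c).len a ^ 2 * Real.exp (-(bG * δ₀ * (geoCK i c).dist a y))))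
    (hP : ∀ c : ↥(cubes (toKT i).D.toDomains), HasMajorant (g := toB6 (geoCK i c) Rr H) (blkBK i c) (conj b ((DPDsCubeY i c parS (V c)).restrictScalars ℝ))
      (fun y b' => KP * ((geoCK i c).len y ^ 2)⁻¹ * Real.exp (-(aP * δ₀ * (geoCK i c).dist y b')))) :
    HasMajorant (g := toB6 (geo9K i) Rr' Hp) (fun p : FBondY i × ι => ιB (blkV1 i.hN i.D p.1))
      (∑ c : ↥(cubes (toKT i).D.toDomains), conj b ((locDefectTBY i c parS parB (u c) (chiY i c) (hTY i c) (V c)).restrictScalars ℝ))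
      (fun a a' => ((3 * 5 ^ (d + 1)) * ((M₂ * ∑ j, ‖b j‖) ^ 2 *
          (BG * KP * Λ * B6.c1 dB δ₀ (aP - ρ) * Real.exp (-(asep * δ₀ * (toKT i).Mh)))) * Λm) *
        (geo9K i).len a * ((geo9K i).len a')⁻¹ * Real.exp (-((1 - αm) * (ρ * δ₀) * (geo9K i).dist a a'))) := by
  have hκ : 0 ≤ BG * KP * Λ * B6.c1 dB δ₀ (aP - ρ) * Real.exp (-(asep * δ₀ * (toKT i).Mh)) :=
    mul_nonneg (mul_nonneg (mul_nonneg (mul_nonneg hBG hKP) hΛ) (c1_nonneg _ _ _)) (Real.exp_nonneg _)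
  have hK : 0 ≤ (3 * 5 ^ (d + 1)) * ((M₂ * ∑ j, ‖b j‖) ^ 2 * (BG * KP * Λ * B6.c1 dB δ₀ (aP - ρ) * Real.exp (-(asep * δ₀ * (toKT i).Mh)))) :=
    mul_nonneg (by positivity) (mul_nonneg (sq_nonneg _) hκ)
  refine hasMajorant_mono (g := toB6 (geo9K i) Rr' Hp) _
    (hasMajorant_sum_conj_locDefectTBY i parS parB b hM₂ hrepr u hu V ιB hι Rr H Rr' Hp dB hδ₀ hKP hBG hΛ hasep hρ hsplit h261 hST hG hP) fun a a' => ?_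
  have h := flat_le_src_weight i (δ := ρ * δ₀) hK hSTm a a'
  calc (3 * 5 ^ (d + 1)) * ((M₂ * ∑ j, ‖b j‖) ^ 2 *
        ((BG * KP * Λ * B6.c1 dB δ₀ (aP - ρ) * Real.exp (-(asep * δ₀ * (toKT i).Mh))) * Real.exp (-(ρ * δ₀ * (geo9K i).dist a a'))))
      = (3 * 5 ^ (d + 1)) * ((M₂ * ∑ j, ‖b j‖) ^ 2 * (BG * KP * Λ * B6.c1 dB δ₀ (aP - ρ) * Real.exp (-(asep * δ₀ * (toKT i).Mh)))) *
          Real.exp (-(ρ * δ₀ * (geo9K i).dist a a')) := by ring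
    _ ≤ _ := h

end Cover

end Literature.MathematicalPhysics.QuantumFieldTheory.Balaban1983to89.B9Cor36GCubeLocDefectCover

end
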